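import Literature.MathematicalPhysics.QuantumFieldTheory.CurvatureGaussianField
import Mathlib.Analysis.SpecialFunctions.Trigonometric.Bounds
import Mathlib.Analysis.SpecificLimits.Basic
import Mathlib.Probability.Moments.Variance
import HarnessLib

/-!
# Stub `stub_factorization` of line `Sketch` (crux `stmt-QuantumFields-8760`)

Route `EquipartitionCriticality` of `YangMills`, crux `EquipartitionCriticality.EquipartitionPinsProbe`, line
`Sketch`, STUB F5 (factorization through the constant `2`-forms). GIVEN the conclusions of the neighbouring stubs
F1, F2 (invariance of `Ψ_S(u) = e^{Q_S(u)/2} (E cos⟨Y,u⟩_S, E sin⟨Y,u⟩_S)` under exact and under cube shifts) and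
the landed density statement R3, a probability measure `τ` on `ℝ^D`-valued `2`-cochains of `ℤ⁴` with (T1), (T2a),
(T3) has `Ψ_S(h) = Ψ_S(h')` whenever `h, h'` have equal plane–colour sums on `S`. Proof: for `ε ∈ (0,1]`, R3 (per
colour, on `g_a = (h' − h)_a 1_S`) gives an exact-plus-cube cochain `w` on a finite `S'' ⊇ S` with
`‖(h' − h) 1_S − w‖_{ℓ¹(S'')} ≤ Dε`; `Ψ_{S''}(h 1_S + w) = Ψ_S(h)` by F2 (cube by cube, `Factorization.apply_add_sum_eq`),
F1 and restriction; `Q`, `E cos`, `E sin` are `ℓ¹`-Lipschitz on bounded sets uniformly in `S''` (`|T(p,q)| ≤ 1/2`,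
`E|Y_p^a| ≤ |B| + 1`), so `Ψ_S(h) = e^{Q₁/2}(c₁, s₁)` with data `O(ε)`-close to those of `h'`; let `ε = 1/(n+1) → 0`.
-/

noncomputable section

open MeasureTheory Filter Topology ProbabilityTheory Literature.MathematicalPhysics.QuantumFieldTheory
  Literature.MathematicalPhysics.QuantumLattice Literature.Probability.LatticeModels

namespace Summit.QuantumFields.YangMills.Theorems.EquipartitionPinsProbe

namespace Factorization

/-- **Invariance under each shift of a finite family gives invariance under their sum.** -/
theorem apply_add_sum_eq {V β ι : Type*} [AddCommMonoid V] (Ψ : V → β) (t : ι → V) (T : Finset ι)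
    (hT : ∀ x ∈ T, ∀ u : V, Ψ (u + t x) = Ψ u) (u : V) : Ψ (u + ∑ x ∈ T, t x) = Ψ u := by
  classical
  induction T using Finset.induction_on generalizing u with
  | empty => rw [Finset.sum_empty, add_zero]
  | insert x T hx ih =>
    rw [Finset.sum_insert hx, ← add_assoc, add_right_comm, hT x (Finset.mem_insert_self x T)]
    exact ih (fun y hy => hT y (Finset.mem_insert_of_mem hy)) u

-- adapted from `GaussianProfile.half_add_nonneg` (p107617, …PinsProbeGaussianProfile.lean)
/-- `|curvatureTwoPoint p q| ≤ 1/2` on `ℤ⁴`: the variances `1 ± 2 T(p,q)` of `Y_p^0 ± Y_q^0` under the one-colour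
curvature Gaussian field are nonnegative (`T(p,p) = 2/4`). -/
theorem abs_curvatureTwoPoint_le (p q : ZdPlaquette 4) : |curvatureTwoPoint p q| ≤ 1 / 2 := by
  have hd : 3 ≤ 4 := by norm_num
  haveI := isProbabilityMeasure_curvatureGaussianField hd 1
  have hG := isGaussianProcess_eval_curvatureGaussianField hd 1
  have hX : MemLp (fun ω : ZdPlaquette 4 → Fin 1 → ℝ => ω p 0) 2 (curvatureGaussianField 4 1) := (hG.hasGaussianLaw_eval (p, 0)).memLp_two
  have hY : MemLp (fun ω : ZdPlaquette 4 → Fin 1 → ℝ => ω q 0) 2 (curvatureGaussianField 4 1) := (hG.hasGaussianLaw_eval (q, 0)).memLp_two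
  have h1 := variance_nonneg ((fun ω : ZdPlaquette 4 → Fin 1 → ℝ => ω p 0) + fun ω => ω q 0) (curvatureGaussianField 4 1)
  have h2 := variance_nonneg ((fun ω : ZdPlaquette 4 → Fin 1 → ℝ => ω p 0) - fun ω => ω q 0) (curvatureGaussianField 4 1)
  rw [variance_add hX hY] at h1; rw [variance_sub hX hY] at h2
  rw [variance_eval_curvatureGaussianField hd, variance_eval_curvatureGaussianField hd,
    covariance_eval_curvatureGaussianField hd, if_pos rfl] at h1 h2
  rw [abs_le]; constructor <;> norm_num at h1 h2 ⊢ <;> linarith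

/-- **First absolute moment from the second**: `E|X| ≤ E X² + 1 ≤ |B| + 1` on a probability space. -/
theorem integral_abs_le_of_sq {Ω : Type*} [MeasurableSpace Ω] (μ : Measure Ω) [IsProbabilityMeasure μ] {X : Ω → ℝ}
    (hX : Integrable X μ) (h2 : Integrable (fun ω => X ω ^ 2) μ) {B : ℝ} (hB : ∫ ω, X ω ^ 2 ∂μ ≤ B) :
    ∫ ω, |X ω| ∂μ ≤ |B| + 1 := by
  calc ∫ ω, |X ω| ∂μ ≤ ∫ ω, (X ω ^ 2 + 1) ∂μ := integral_mono hX.abs (h2.add (integrable_const 1)) fun ω => by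
          have := two_mul_le_add_sq |X ω| 1; rw [sq_abs] at this; dsimp only
          nlinarith [abs_nonneg (X ω), sq_nonneg (X ω)]
    _ = ∫ ω, X ω ^ 2 ∂μ + 1 := by rw [integral_add h2 (integrable_const 1), integral_const]; simp
    _ ≤ |B| + 1 := by linarith [le_abs_self B]

/-- **Limit step**: if `(Lc, Ls) = e^{Q₁/2} (c₁, s₁)` with `(Q₁, c₁, s₁)` within `O(ε)` of `(Q', c', s')` for every
`ε ∈ (0, 1]`, then `(Lc, Ls) = e^{Q'/2} (c', s')` (`ε = 1/(n+1)`, continuity of `exp` and of multiplication). -/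
theorem eq_of_approx {Lc Ls Q' c' s' C₁ C₂ : ℝ} (H : ∀ ε : ℝ, 0 < ε → ε ≤ 1 → ∃ Q₁ c₁ s₁ : ℝ,
      Real.exp (Q₁ / 2) * c₁ = Lc ∧ Real.exp (Q₁ / 2) * s₁ = Ls ∧
        |Q₁ - Q'| ≤ C₁ * ε ∧ |c₁ - c'| ≤ C₂ * ε ∧ |s₁ - s'| ≤ C₂ * ε) :
    Lc = Real.exp (Q' / 2) * c' ∧ Ls = Real.exp (Q' / 2) * s' := by
  choose Q c s hc hs hQ hcc hss using fun n : ℕ => H (1 / ((n : ℝ) + 1)) Nat.one_div_pos_of_nat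
    ((div_le_one (Nat.cast_add_one_pos n)).2 (by linarith [n.cast_nonneg (α := ℝ)]))
  have lim : ∀ {x : ℕ → ℝ} {x' C : ℝ}, (∀ n : ℕ, |x n - x'| ≤ C * (1 / ((n : ℝ) + 1))) → Tendsto x atTop (𝓝 x') :=
    fun {x x' C} hx => tendsto_sub_nhds_zero_iff.mp (squeeze_zero_norm (fun n => (Real.norm_eq_abs _).le.trans (hx n))
      (by simpa using (tendsto_one_div_add_atTop_nhds_zero_nat (𝕜 := ℝ)).const_mul C))
  have hE := (Real.continuous_exp.tendsto _).comp ((lim hQ).div_const 2)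
  constructor
  · have h1 := hE.mul (lim hcc); rw [show (fun n => (Real.exp ∘ fun n => Q n / 2) n * c n) = fun _ => Lc from funext hc] at h1
    exact tendsto_const_nhds_iff.mp h1
  · have h1 := hE.mul (lim hss); rw [show (fun n => (Real.exp ∘ fun n => Q n / 2) n * s n) = fun _ => Ls from funext hs] at h1
    exact tendsto_const_nhds_iff.mp h1

/-- **`ℓ¹`-continuity of `Q_S(u) = ∑_{p,q ∈ S} ∑_a u_p^a u_q^a T(p,q)`** for a kernel with `|T| ≤ 1/2`:
`|Q_S(u) − Q_S(v)| ≤ ½ (‖u‖₁ + ‖v‖₁) ‖u − v‖₁` (all norms on `S`). -/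
theorem abs_quad_sub_quad_le {P : Type*} {D : ℕ} (T : P → P → ℝ) (hT : ∀ p q, |T p q| ≤ 1 / 2) (S : Finset P)
    (u v : P → Fin D → ℝ) :
    |(∑ p ∈ S, ∑ q ∈ S, ∑ a : Fin D, u p a * u q a * T p q) - ∑ p ∈ S, ∑ q ∈ S, ∑ a : Fin D, v p a * v q a * T p q|
      ≤ 1 / 2 * ((∑ p ∈ S, ∑ a : Fin D, |u p a|) + ∑ p ∈ S, ∑ a : Fin D, |v p a|) * ∑ p ∈ S, ∑ a : Fin D, |u p a - v p a| := by
  -- `∑_{p,q,a} |x_p^a| |y_q^a| ≤ ‖x‖₁ ‖y‖₁` (complete the colour diagonal to all pairs of colours)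
  have key : ∀ x y : P → Fin D → ℝ, ∑ p ∈ S, ∑ q ∈ S, ∑ a : Fin D, |x p a| * |y q a| ≤
      (∑ p ∈ S, ∑ a : Fin D, |x p a|) * ∑ q ∈ S, ∑ a : Fin D, |y q a| := fun x y => by
    rw [Finset.sum_mul]; refine Finset.sum_le_sum fun p _ => ?_
    rw [Finset.sum_comm, Finset.sum_mul]; refine Finset.sum_le_sum fun a _ => ?_
    rw [← Finset.mul_sum]
    exact mul_le_mul_of_nonneg_left (Finset.sum_le_sum fun q _ => Finset.single_le_sum
      (f := fun b => |y q b|) (fun b _ => abs_nonneg _) (Finset.mem_univ a)) (abs_nonneg _)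
  calc |(∑ p ∈ S, ∑ q ∈ S, ∑ a : Fin D, u p a * u q a * T p q) - ∑ p ∈ S, ∑ q ∈ S, ∑ a : Fin D, v p a * v q a * T p q|
      = |∑ p ∈ S, ∑ q ∈ S, ∑ a : Fin D, (u p a * (u q a - v q a) + (u p a - v p a) * v q a) * T p q| := by
        simp only [← Finset.sum_sub_distrib]
        exact congrArg _ (Finset.sum_congr rfl fun p _ => Finset.sum_congr rfl fun q _ =>
          Finset.sum_congr rfl fun a _ => by ring)
    _ ≤ ∑ p ∈ S, ∑ q ∈ S, ∑ a : Fin D, (|u p a| * |u q a - v q a| + |u p a - v p a| * |v q a|) * (1 / 2) := by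
        refine (Finset.abs_sum_le_sum_abs _ _).trans (Finset.sum_le_sum fun p _ => (Finset.abs_sum_le_sum_abs _ _).trans
          (Finset.sum_le_sum fun q _ => (Finset.abs_sum_le_sum_abs _ _).trans (Finset.sum_le_sum fun a _ => ?_)))
        rw [abs_mul]; refine mul_le_mul ?_ (hT p q) (abs_nonneg _) (by positivity)
        simpa only [abs_mul] using abs_add_le (u p a * (u q a - v q a)) ((u p a - v p a) * v q a)
    _ = 1 / 2 * ((∑ p ∈ S, ∑ q ∈ S, ∑ a : Fin D, |u p a| * |u q a - v q a|) +
          ∑ p ∈ S, ∑ q ∈ S, ∑ a : Fin D, |u p a - v p a| * |v q a|) := by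
        simp only [Finset.sum_add_distrib, ← Finset.sum_mul]; ring
    _ ≤ 1 / 2 * ((∑ p ∈ S, ∑ a : Fin D, |u p a|) * (∑ p ∈ S, ∑ a : Fin D, |u p a - v p a|) +
          (∑ p ∈ S, ∑ a : Fin D, |u p a - v p a|) * ∑ p ∈ S, ∑ a : Fin D, |v p a|) := by
        gcongr; exacts [key u (u - v), key (u - v) v]
    _ = _ := by ring

/-- **`ℓ¹`-continuity of `u ↦ E f(⟨Y,u⟩_S)`** for `f` continuous, bounded by `1` and `1`-Lipschitz (`cos`, `sin`):
`|E f⟨Y,u⟩_S − E f⟨Y,v⟩_S| ≤ M ‖u − v‖₁` whenever `E|Y_p^a| ≤ M` for all `(p, a)`. -/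
theorem abs_integral_sub_integral_le {P : Type*} {D : ℕ} (τ : Measure (P → Fin D → ℝ)) [IsFiniteMeasure τ]
    (hInt : ∀ (p : P) (a : Fin D), Integrable (fun Y : P → Fin D → ℝ => Y p a) τ) {M : ℝ}
    (hM : ∀ (p : P) (a : Fin D), ∫ Y, |Y p a| ∂τ ≤ M) {f : ℝ → ℝ} (hf : Continuous f) (hf1 : ∀ x, |f x| ≤ 1)
    (hfL : ∀ x y, |f x - f y| ≤ |x - y|) (S : Finset P) (u v : P → Fin D → ℝ) :
    |(∫ Y, f (∑ p ∈ S, ∑ a : Fin D, u p a * Y p a) ∂τ) - ∫ Y, f (∑ p ∈ S, ∑ a : Fin D, v p a * Y p a) ∂τ|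
      ≤ M * ∑ p ∈ S, ∑ a : Fin D, |u p a - v p a| := by
  have hF : ∀ w : P → Fin D → ℝ, Integrable (fun Y : P → Fin D → ℝ => f (∑ p ∈ S, ∑ a : Fin D, w p a * Y p a)) τ :=
    fun w => (integrable_const (1 : ℝ)).mono' (hf.comp_aestronglyMeasurable (integrable_finsetSum S fun p _ =>
      integrable_finsetSum _ fun a _ => (hInt p a).const_mul (w p a)).aestronglyMeasurable)
        (ae_of_all _ fun Y => by simpa only [Real.norm_eq_abs] using hf1 _)
  have hG : ∀ p ∈ S, Integrable (fun Y : P → Fin D → ℝ => ∑ a : Fin D, |u p a - v p a| * |Y p a|) τ :=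
    fun p _ => integrable_finsetSum _ fun a _ => (hInt p a).abs.const_mul _
  rw [← integral_sub (hF u) (hF v)]
  calc |∫ Y, (f (∑ p ∈ S, ∑ a : Fin D, u p a * Y p a) - f (∑ p ∈ S, ∑ a : Fin D, v p a * Y p a)) ∂τ|
      ≤ ∫ Y, |f (∑ p ∈ S, ∑ a : Fin D, u p a * Y p a) - f (∑ p ∈ S, ∑ a : Fin D, v p a * Y p a)| ∂τ :=
        abs_integral_le_integral_abs
    _ ≤ ∫ Y, ∑ p ∈ S, ∑ a : Fin D, |u p a - v p a| * |Y p a| ∂τ := by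
        refine integral_mono_of_nonneg (ae_of_all _ fun _ => abs_nonneg _) (integrable_finsetSum S hG)
          (ae_of_all _ fun Y => (hfL _ _).trans ?_)
        rw [← Finset.sum_sub_distrib]
        refine (Finset.abs_sum_le_sum_abs _ _).trans (Finset.sum_le_sum fun p _ => ?_)
        rw [← Finset.sum_sub_distrib]
        exact (Finset.abs_sum_le_sum_abs _ _).trans (Finset.sum_le_sum fun a _ => by rw [← sub_mul, abs_mul])
    _ = ∑ p ∈ S, ∑ a : Fin D, |u p a - v p a| * ∫ Y, |Y p a| ∂τ := by
        rw [integral_finsetSum S hG]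
        refine Finset.sum_congr rfl fun p hp => ?_
        rw [integral_finsetSum Finset.univ fun a _ => (hInt p a).abs.const_mul _]
        exact Finset.sum_congr rfl fun a _ => integral_const_mul _ _
    _ ≤ ∑ p ∈ S, ∑ a : Fin D, |u p a - v p a| * M :=
        Finset.sum_le_sum fun p _ => Finset.sum_le_sum fun a _ => mul_le_mul_of_nonneg_left (hM p a) (abs_nonneg _)
    _ = M * ∑ p ∈ S, ∑ a : Fin D, |u p a - v p a| := by
        rw [Finset.mul_sum]; refine Finset.sum_congr rfl fun p _ => ?_
        rw [Finset.mul_sum]; exact Finset.sum_congr rfl fun a _ => mul_comm _ _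

/-- Extending the plaquette set does not change the pairing of a cochain truncated to `S`. -/
theorem sum_ite_mul_eq {P : Type*} [DecidableEq P] {D : ℕ} {S S'' : Finset P} (hS : S ⊆ S'') (h Y : P → Fin D → ℝ) :
    ∑ p ∈ S'', ∑ a : Fin D, (if p ∈ S then h p a else 0) * Y p a = ∑ p ∈ S, ∑ a : Fin D, h p a * Y p a := by
  rw [← Finset.sum_subset hS fun p _ hp => by simp [hp]]
  exact Finset.sum_congr rfl fun p hp => by simp [hp]

/-- Extending the plaquette set does not change the `ℓ¹`-norm of a cochain truncated to `S`. -/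
theorem sum_abs_ite_eq {P : Type*} [DecidableEq P] {D : ℕ} {S S'' : Finset P} (hS : S ⊆ S'') (h : P → Fin D → ℝ) :
    ∑ p ∈ S'', ∑ a : Fin D, |(if p ∈ S then h p a else 0)| = ∑ p ∈ S, ∑ a : Fin D, |h p a| := by
  rw [← Finset.sum_subset hS fun p _ hp => by simp [hp]]
  exact Finset.sum_congr rfl fun p hp => by simp [hp]

/-- Extending the plaquette set does not change the quadratic functional of a truncated cochain. -/
theorem sum_sum_ite_mul_ite_eq {P : Type*} [DecidableEq P] {D : ℕ} {S S'' : Finset P} (hS : S ⊆ S'')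
    (h : P → Fin D → ℝ) (T : P → P → ℝ) :
    ∑ p ∈ S'', ∑ q ∈ S'', ∑ a : Fin D, (if p ∈ S then h p a else 0) * (if q ∈ S then h q a else 0) * T p q =
      ∑ p ∈ S, ∑ q ∈ S, ∑ a : Fin D, h p a * h q a * T p q := by
  rw [← Finset.sum_subset hS fun p _ hp => by simp [hp]]
  refine Finset.sum_congr rfl fun p hp => ?_
  rw [← Finset.sum_subset hS fun q _ hq => by simp [hq]]
  exact Finset.sum_congr rfl fun q hq => by simp [hp, hq]

end Factorization

/-- STUB F5 — **factorization through the constant 2-forms**: GIVEN the conclusions of STUBS F1, F2 (invariance of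
`Ψ = e^{Q/2}Φ_τ` under exact and cube shifts) and the statement of STUB R3 (density), `Ψ_S(h) = Ψ_S(h')` for a
probability measure `τ` with (T1), (T2a), (T3) whenever the plane–colour sums of `h` and `h'` on `S` agree.
(Statement: the registered skeleton signature, token for token, re-wrapped to long lines for the file-size rule.) -/
theorem stub_factorization :
    -- (F1, conclusion)
    (∀ (D : ℕ) (τ : MeasureTheory.Measure (Literature.MathematicalPhysics.QuantumLattice.ZdPlaquette 4 → Fin D → ℝ)), MeasureTheory.IsProbabilityMeasure τ → (∀ (p :
      Literature.MathematicalPhysics.QuantumLattice.ZdPlaquette 4) (a : Fin D), MeasureTheory.Integrable (fun Y : Literature.MathematicalPhysics.QuantumLattice.ZdPlaquette 4 → Fin D → ℝ => Y p a) τ) →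
      (∀ (S : Finset (Literature.MathematicalPhysics.QuantumLattice.ZdPlaquette 4)) (E : Finset (Literature.MathematicalPhysics.QuantumLattice.ZdEdge 4)) (h :
      Literature.MathematicalPhysics.QuantumLattice.ZdPlaquette 4 → Fin D → ℝ) (α : Literature.MathematicalPhysics.QuantumLattice.ZdEdge 4 → Fin D → ℝ), (∀ e, e ∉ E → α e = 0) → (∀ p, p ∉ S → ∀ a :
      Fin D, Literature.MathematicalPhysics.QuantumFieldTheory.plaquetteCurl (fun e => α e a) p = 0) → (∫ Y, Real.cos (∑ p ∈ S, ∑ a : Fin D, h p a * Y p a) * (∑ p ∈ S, ∑ a : Fin D,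
      Literature.MathematicalPhysics.QuantumFieldTheory.plaquetteCurl (fun e => α e a) p * Y p a) ∂τ = -(∑ p ∈ S, ∑ a : Fin D, Literature.MathematicalPhysics.QuantumFieldTheory.plaquetteCurl (fun e =>
      α e a) p * h p a) * ∫ Y, Real.sin (∑ p ∈ S, ∑ a : Fin D, h p a * Y p a) ∂τ) ∧ (∫ Y, Real.sin (∑ p ∈ S, ∑ a : Fin D, h p a * Y p a) * (∑ p ∈ S, ∑ a : Fin D,
      Literature.MathematicalPhysics.QuantumFieldTheory.plaquetteCurl (fun e => α e a) p * Y p a) ∂τ = (∑ p ∈ S, ∑ a : Fin D, Literature.MathematicalPhysics.QuantumFieldTheory.plaquetteCurl (fun e =>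
      α e a) p * h p a) * ∫ Y, Real.cos (∑ p ∈ S, ∑ a : Fin D, h p a * Y p a) ∂τ)) → ∀ (S : Finset (Literature.MathematicalPhysics.QuantumLattice.ZdPlaquette 4)) (E : Finset
      (Literature.MathematicalPhysics.QuantumLattice.ZdEdge 4)) (h : Literature.MathematicalPhysics.QuantumLattice.ZdPlaquette 4 → Fin D → ℝ) (α : Literature.MathematicalPhysics.QuantumLattice.ZdEdge
      4 → Fin D → ℝ), (∀ e, e ∉ E → α e = 0) → (∀ p, p ∉ S → ∀ a : Fin D, Literature.MathematicalPhysics.QuantumFieldTheory.plaquetteCurl (fun e => α e a) p = 0) → (Real.exp ((∑ p ∈ S, ∑ q ∈ S, ∑ a :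
      Fin D, (h p a + Literature.MathematicalPhysics.QuantumFieldTheory.plaquetteCurl (fun e => α e a) p) * (h q a + Literature.MathematicalPhysics.QuantumFieldTheory.plaquetteCurl (fun e => α e a) q)
      * Literature.MathematicalPhysics.QuantumFieldTheory.curvatureTwoPoint p q) / 2) * ∫ Y, Real.cos (∑ p ∈ S, ∑ a : Fin D, (h p a + Literature.MathematicalPhysics.QuantumFieldTheory.plaquetteCurl
      (fun e => α e a) p) * Y p a) ∂τ = Real.exp ((∑ p ∈ S, ∑ q ∈ S, ∑ a : Fin D, h p a * h q a * Literature.MathematicalPhysics.QuantumFieldTheory.curvatureTwoPoint p q) / 2) * ∫ Y, Real.cos (∑ p ∈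
      S, ∑ a : Fin D, h p a * Y p a) ∂τ) ∧ (Real.exp ((∑ p ∈ S, ∑ q ∈ S, ∑ a : Fin D, (h p a + Literature.MathematicalPhysics.QuantumFieldTheory.plaquetteCurl (fun e => α e a) p) * (h q a +
      Literature.MathematicalPhysics.QuantumFieldTheory.plaquetteCurl (fun e => α e a) q) * Literature.MathematicalPhysics.QuantumFieldTheory.curvatureTwoPoint p q) / 2) * ∫ Y, Real.sin (∑ p ∈ S, ∑ a
      : Fin D, (h p a + Literature.MathematicalPhysics.QuantumFieldTheory.plaquetteCurl (fun e => α e a) p) * Y p a) ∂τ = Real.exp ((∑ p ∈ S, ∑ q ∈ S, ∑ a : Fin D, h p a * h q a *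
      Literature.MathematicalPhysics.QuantumFieldTheory.curvatureTwoPoint p q) / 2) * ∫ Y, Real.sin (∑ p ∈ S, ∑ a : Fin D, h p a * Y p a) ∂τ)) →
    -- (F2, conclusion)
    (∀ (D : ℕ) (τ : MeasureTheory.Measure (Literature.MathematicalPhysics.QuantumLattice.ZdPlaquette 4 → Fin D → ℝ)), (∀ (x : Literature.Probability.LatticeModels.Site 4) (i j k : Fin 4) (hij : i < j)
      (hjk : j < k) (a : Fin D), ∀ᵐ Y ∂τ, (Y (x + Pi.single i 1, ⟨(j, k), hjk⟩) a - Y (x, ⟨(j, k), hjk⟩) a) - (Y (x + Pi.single j 1, ⟨(i, k), hij.trans hjk⟩) a - Y (x, ⟨(i, k), hij.trans hjk⟩) a) + (Y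
      (x + Pi.single k 1, ⟨(i, j), hij⟩) a - Y (x, ⟨(i, j), hij⟩) a) = 0) → ∀ (S : Finset (Literature.MathematicalPhysics.QuantumLattice.ZdPlaquette 4)) (h :
      Literature.MathematicalPhysics.QuantumLattice.ZdPlaquette 4 → Fin D → ℝ) (x : Literature.Probability.LatticeModels.Site 4) (i j k : Fin 4) (hij : i < j) (hjk : j < k) (b : Fin D) (r : ℝ), (x +
      Pi.single i 1, ⟨(j, k), hjk⟩) ∈ S → (x, ⟨(j, k), hjk⟩) ∈ S → (x + Pi.single j 1, ⟨(i, k), hij.trans hjk⟩) ∈ S → (x, ⟨(i, k), hij.trans hjk⟩) ∈ S → (x + Pi.single k 1, ⟨(i, j), hij⟩) ∈ S → (x,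
      ⟨(i, j), hij⟩) ∈ S → (Real.exp ((∑ p ∈ S, ∑ q ∈ S, ∑ a : Fin D, (fun (p : Literature.MathematicalPhysics.QuantumLattice.ZdPlaquette 4) (a : Fin D) => h p a + (if a = b then r * ((if p = (x +
      Pi.single i 1, ⟨(j, k), hjk⟩) then (1 : ℝ) else 0) - (if p = (x, ⟨(j, k), hjk⟩) then (1 : ℝ) else 0) - (if p = (x + Pi.single j 1, ⟨(i, k), hij.trans hjk⟩) then (1 : ℝ) else 0) + (if p = (x,
      ⟨(i, k), hij.trans hjk⟩) then (1 : ℝ) else 0) + (if p = (x + Pi.single k 1, ⟨(i, j), hij⟩) then (1 : ℝ) else 0) - (if p = (x, ⟨(i, j), hij⟩) then (1 : ℝ) else 0)) else 0)) p a * (fun (p :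
      Literature.MathematicalPhysics.QuantumLattice.ZdPlaquette 4) (a : Fin D) => h p a + (if a = b then r * ((if p = (x + Pi.single i 1, ⟨(j, k), hjk⟩) then (1 : ℝ) else 0) - (if p = (x, ⟨(j, k),
      hjk⟩) then (1 : ℝ) else 0) - (if p = (x + Pi.single j 1, ⟨(i, k), hij.trans hjk⟩) then (1 : ℝ) else 0) + (if p = (x, ⟨(i, k), hij.trans hjk⟩) then (1 : ℝ) else 0) + (if p = (x + Pi.single k 1,
      ⟨(i, j), hij⟩) then (1 : ℝ) else 0) - (if p = (x, ⟨(i, j), hij⟩) then (1 : ℝ) else 0)) else 0)) q a * Literature.MathematicalPhysics.QuantumFieldTheory.curvatureTwoPoint p q) / 2) * ∫ Y,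
      Real.cos (∑ p ∈ S, ∑ a : Fin D, (fun (p : Literature.MathematicalPhysics.QuantumLattice.ZdPlaquette 4) (a : Fin D) => h p a + (if a = b then r * ((if p = (x + Pi.single i 1, ⟨(j, k), hjk⟩) then
      (1 : ℝ) else 0) - (if p = (x, ⟨(j, k), hjk⟩) then (1 : ℝ) else 0) - (if p = (x + Pi.single j 1, ⟨(i, k), hij.trans hjk⟩) then (1 : ℝ) else 0) + (if p = (x, ⟨(i, k), hij.trans hjk⟩) then (1 : ℝ)
      else 0) + (if p = (x + Pi.single k 1, ⟨(i, j), hij⟩) then (1 : ℝ) else 0) - (if p = (x, ⟨(i, j), hij⟩) then (1 : ℝ) else 0)) else 0)) p a * Y p a) ∂τ = Real.exp ((∑ p ∈ S, ∑ q ∈ S, ∑ a : Fin D,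
      h p a * h q a * Literature.MathematicalPhysics.QuantumFieldTheory.curvatureTwoPoint p q) / 2) * ∫ Y, Real.cos (∑ p ∈ S, ∑ a : Fin D, h p a * Y p a) ∂τ) ∧ (Real.exp ((∑ p ∈ S, ∑ q ∈ S, ∑ a : Fin
      D, (fun (p : Literature.MathematicalPhysics.QuantumLattice.ZdPlaquette 4) (a : Fin D) => h p a + (if a = b then r * ((if p = (x + Pi.single i 1, ⟨(j, k), hjk⟩) then (1 : ℝ) else 0) - (if p = (x,
      ⟨(j, k), hjk⟩) then (1 : ℝ) else 0) - (if p = (x + Pi.single j 1, ⟨(i, k), hij.trans hjk⟩) then (1 : ℝ) else 0) + (if p = (x, ⟨(i, k), hij.trans hjk⟩) then (1 : ℝ) else 0) + (if p = (x +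
      Pi.single k 1, ⟨(i, j), hij⟩) then (1 : ℝ) else 0) - (if p = (x, ⟨(i, j), hij⟩) then (1 : ℝ) else 0)) else 0)) p a * (fun (p : Literature.MathematicalPhysics.QuantumLattice.ZdPlaquette 4) (a :
      Fin D) => h p a + (if a = b then r * ((if p = (x + Pi.single i 1, ⟨(j, k), hjk⟩) then (1 : ℝ) else 0) - (if p = (x, ⟨(j, k), hjk⟩) then (1 : ℝ) else 0) - (if p = (x + Pi.single j 1, ⟨(i, k),
      hij.trans hjk⟩) then (1 : ℝ) else 0) + (if p = (x, ⟨(i, k), hij.trans hjk⟩) then (1 : ℝ) else 0) + (if p = (x + Pi.single k 1, ⟨(i, j), hij⟩) then (1 : ℝ) else 0) - (if p = (x, ⟨(i, j), hij⟩)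
      then (1 : ℝ) else 0)) else 0)) q a * Literature.MathematicalPhysics.QuantumFieldTheory.curvatureTwoPoint p q) / 2) * ∫ Y, Real.sin (∑ p ∈ S, ∑ a : Fin D, (fun (p :
      Literature.MathematicalPhysics.QuantumLattice.ZdPlaquette 4) (a : Fin D) => h p a + (if a = b then r * ((if p = (x + Pi.single i 1, ⟨(j, k), hjk⟩) then (1 : ℝ) else 0) - (if p = (x, ⟨(j, k),
      hjk⟩) then (1 : ℝ) else 0) - (if p = (x + Pi.single j 1, ⟨(i, k), hij.trans hjk⟩) then (1 : ℝ) else 0) + (if p = (x, ⟨(i, k), hij.trans hjk⟩) then (1 : ℝ) else 0) + (if p = (x + Pi.single k 1,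
      ⟨(i, j), hij⟩) then (1 : ℝ) else 0) - (if p = (x, ⟨(i, j), hij⟩) then (1 : ℝ) else 0)) else 0)) p a * Y p a) ∂τ = Real.exp ((∑ p ∈ S, ∑ q ∈ S, ∑ a : Fin D, h p a * h q a *
      Literature.MathematicalPhysics.QuantumFieldTheory.curvatureTwoPoint p q) / 2) * ∫ Y, Real.sin (∑ p ∈ S, ∑ a : Fin D, h p a * Y p a) ∂τ)) →
    -- (R3)
    (∀ (g : Literature.MathematicalPhysics.QuantumLattice.ZdPlaquette 4 → ℝ) (S : Finset (Literature.MathematicalPhysics.QuantumLattice.ZdPlaquette 4)), (∀ p, p ∉ S → g p = 0) → (∀ (i j : Fin 4) (hij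
      : i < j), ∑ p ∈ S, (if p.2 = ⟨(i, j), hij⟩ then g p else 0) = 0) → ∀ ε : ℝ, 0 < ε → ∃ (S' : Finset (Literature.MathematicalPhysics.QuantumLattice.ZdPlaquette 4)) (E : Finset
      (Literature.MathematicalPhysics.QuantumLattice.ZdEdge 4)) (α : Literature.MathematicalPhysics.QuantumLattice.ZdEdge 4 → ℝ) (K : Finset (Literature.Probability.LatticeModels.Site 4 × Fin 4 × Fin
      4 × Fin 4)) (r : Literature.Probability.LatticeModels.Site 4 × Fin 4 × Fin 4 × Fin 4 → ℝ), S ⊆ S' ∧ (∀ e, e ∉ E → α e = 0) ∧ (∀ p, p ∉ S' →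
      Literature.MathematicalPhysics.QuantumFieldTheory.plaquetteCurl α p = 0) ∧ (∀ κ ∈ K, κ.2.1 < κ.2.2.1 ∧ κ.2.2.1 < κ.2.2.2 ∧ ∀ p : Literature.MathematicalPhysics.QuantumLattice.ZdPlaquette 4, (fun
      (κ : Literature.Probability.LatticeModels.Site 4 × Fin 4 × Fin 4 × Fin 4) (p : Literature.MathematicalPhysics.QuantumLattice.ZdPlaquette 4) => if hκ : κ.2.1 < κ.2.2.1 ∧ κ.2.2.1 < κ.2.2.2 then
      ((if p = (κ.1 + Pi.single κ.2.1 1, ⟨(κ.2.2.1, κ.2.2.2), hκ.2⟩) then (1 : ℝ) else 0) - (if p = (κ.1, ⟨(κ.2.2.1, κ.2.2.2), hκ.2⟩) then (1 : ℝ) else 0) - (if p = (κ.1 + Pi.single κ.2.2.1 1,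
      ⟨(κ.2.1, κ.2.2.2), hκ.1.trans hκ.2⟩) then (1 : ℝ) else 0) + (if p = (κ.1, ⟨(κ.2.1, κ.2.2.2), hκ.1.trans hκ.2⟩) then (1 : ℝ) else 0) + (if p = (κ.1 + Pi.single κ.2.2.2 1, ⟨(κ.2.1, κ.2.2.1),
      hκ.1⟩) then (1 : ℝ) else 0) - (if p = (κ.1, ⟨(κ.2.1, κ.2.2.1), hκ.1⟩) then (1 : ℝ) else 0)) else 0) κ p ≠ 0 → p ∈ S') ∧ ∑ p ∈ S', |g p -
      Literature.MathematicalPhysics.QuantumFieldTheory.plaquetteCurl α p - ∑ κ ∈ K, r κ * (fun (κ : Literature.Probability.LatticeModels.Site 4 × Fin 4 × Fin 4 × Fin 4) (p :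
      Literature.MathematicalPhysics.QuantumLattice.ZdPlaquette 4) => if hκ : κ.2.1 < κ.2.2.1 ∧ κ.2.2.1 < κ.2.2.2 then ((if p = (κ.1 + Pi.single κ.2.1 1, ⟨(κ.2.2.1, κ.2.2.2), hκ.2⟩) then (1 : ℝ) else
      0) - (if p = (κ.1, ⟨(κ.2.2.1, κ.2.2.2), hκ.2⟩) then (1 : ℝ) else 0) - (if p = (κ.1 + Pi.single κ.2.2.1 1, ⟨(κ.2.1, κ.2.2.2), hκ.1.trans hκ.2⟩) then (1 : ℝ) else 0) + (if p = (κ.1, ⟨(κ.2.1,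
      κ.2.2.2), hκ.1.trans hκ.2⟩) then (1 : ℝ) else 0) + (if p = (κ.1 + Pi.single κ.2.2.2 1, ⟨(κ.2.1, κ.2.2.1), hκ.1⟩) then (1 : ℝ) else 0) - (if p = (κ.1, ⟨(κ.2.1, κ.2.2.1), hκ.1⟩) then (1 : ℝ) else
      0)) else 0) κ p| < ε) → ∀ (D : ℕ) (τ : MeasureTheory.Measure (Literature.MathematicalPhysics.QuantumLattice.ZdPlaquette 4 → Fin D → ℝ)), MeasureTheory.IsProbabilityMeasure τ → (∀ (p :
      Literature.MathematicalPhysics.QuantumLattice.ZdPlaquette 4) (a : Fin D), MeasureTheory.Integrable (fun Y : Literature.MathematicalPhysics.QuantumLattice.ZdPlaquette 4 → Fin D → ℝ => Y p a) τ) →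
      (∀ (x : Literature.Probability.LatticeModels.Site 4) (i j k : Fin 4) (hij : i < j) (hjk : j < k) (a : Fin D), ∀ᵐ Y ∂τ, (Y (x + Pi.single i 1, ⟨(j, k), hjk⟩) a - Y (x, ⟨(j, k), hjk⟩) a) - (Y (x +
      Pi.single j 1, ⟨(i, k), hij.trans hjk⟩) a - Y (x, ⟨(i, k), hij.trans hjk⟩) a) + (Y (x + Pi.single k 1, ⟨(i, j), hij⟩) a - Y (x, ⟨(i, j), hij⟩) a) = 0) → (∃ B : ℝ, ∀ (p :
      Literature.MathematicalPhysics.QuantumLattice.ZdPlaquette 4) (a : Fin D), MeasureTheory.Integrable (fun Y => (Y p a) ^ 2) τ ∧ ∫ Y, (Y p a) ^ 2 ∂τ ≤ B) → (∀ (S : Finset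
      (Literature.MathematicalPhysics.QuantumLattice.ZdPlaquette 4)) (E : Finset (Literature.MathematicalPhysics.QuantumLattice.ZdEdge 4)) (h :
      Literature.MathematicalPhysics.QuantumLattice.ZdPlaquette 4 → Fin D → ℝ) (α : Literature.MathematicalPhysics.QuantumLattice.ZdEdge 4 → Fin D → ℝ), (∀ e, e ∉ E → α e = 0) → (∀ p, p ∉ S → ∀ a :
      Fin D, Literature.MathematicalPhysics.QuantumFieldTheory.plaquetteCurl (fun e => α e a) p = 0) → (∫ Y, Real.cos (∑ p ∈ S, ∑ a : Fin D, h p a * Y p a) * (∑ p ∈ S, ∑ a : Fin D,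
      Literature.MathematicalPhysics.QuantumFieldTheory.plaquetteCurl (fun e => α e a) p * Y p a) ∂τ = -(∑ p ∈ S, ∑ a : Fin D, Literature.MathematicalPhysics.QuantumFieldTheory.plaquetteCurl (fun e =>
      α e a) p * h p a) * ∫ Y, Real.sin (∑ p ∈ S, ∑ a : Fin D, h p a * Y p a) ∂τ) ∧ (∫ Y, Real.sin (∑ p ∈ S, ∑ a : Fin D, h p a * Y p a) * (∑ p ∈ S, ∑ a : Fin D,
      Literature.MathematicalPhysics.QuantumFieldTheory.plaquetteCurl (fun e => α e a) p * Y p a) ∂τ = (∑ p ∈ S, ∑ a : Fin D, Literature.MathematicalPhysics.QuantumFieldTheory.plaquetteCurl (fun e =>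
      α e a) p * h p a) * ∫ Y, Real.cos (∑ p ∈ S, ∑ a : Fin D, h p a * Y p a) ∂τ)) → ∀ (S : Finset (Literature.MathematicalPhysics.QuantumLattice.ZdPlaquette 4)) (h h' :
      Literature.MathematicalPhysics.QuantumLattice.ZdPlaquette 4 → Fin D → ℝ), (∀ (i j : Fin 4) (hij : i < j) (a : Fin D), ∑ p ∈ S, (if p.2 = ⟨(i, j), hij⟩ then h p a else 0) = ∑ p ∈ S, (if p.2 =
      ⟨(i, j), hij⟩ then h' p a else 0)) → (Real.exp ((∑ p ∈ S, ∑ q ∈ S, ∑ a : Fin D, h p a * h q a * Literature.MathematicalPhysics.QuantumFieldTheory.curvatureTwoPoint p q) / 2) * ∫ Y, Real.cos (∑ p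
      ∈ S, ∑ a : Fin D, h p a * Y p a) ∂τ = Real.exp ((∑ p ∈ S, ∑ q ∈ S, ∑ a : Fin D, h' p a * h' q a * Literature.MathematicalPhysics.QuantumFieldTheory.curvatureTwoPoint p q) / 2) * ∫ Y, Real.cos (∑
      p ∈ S, ∑ a : Fin D, h' p a * Y p a) ∂τ) ∧ (Real.exp ((∑ p ∈ S, ∑ q ∈ S, ∑ a : Fin D, h p a * h q a * Literature.MathematicalPhysics.QuantumFieldTheory.curvatureTwoPoint p q) / 2) * ∫ Y, Real.sin
      (∑ p ∈ S, ∑ a : Fin D, h p a * Y p a) ∂τ = Real.exp ((∑ p ∈ S, ∑ q ∈ S, ∑ a : Fin D, h' p a * h' q a * Literature.MathematicalPhysics.QuantumFieldTheory.curvatureTwoPoint p q) / 2) * ∫ Y,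
      Real.sin (∑ p ∈ S, ∑ a : Fin D, h' p a * Y p a) ∂τ) := by
  intro HF1 HF2 HR3 D τ hτ hInt hT1 hT2 hT3 S h h' hplane
  obtain ⟨B, hB⟩ := hT2; haveI := hτ
  have hM : ∀ (p : ZdPlaquette 4) (a : Fin D), ∫ Y, |Y p a| ∂τ ≤ |B| + 1 := fun p a =>
    Factorization.integral_abs_le_of_sq τ (hInt p a) (hB p a).1 (hB p a).2
  -- the functional `Ψ_{S₀}(u) = e^{Q_{S₀}(u)/2} (E cos⟨Y,u⟩_{S₀}, E sin⟨Y,u⟩_{S₀})`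
  obtain ⟨Ψ, hΨ⟩ : ∃ Ψ : Finset (ZdPlaquette 4) → (ZdPlaquette 4 → Fin D → ℝ) → ℝ × ℝ, ∀ S₀ u, Ψ S₀ u =
      (Real.exp ((∑ p ∈ S₀, ∑ q ∈ S₀, ∑ a : Fin D, u p a * u q a * curvatureTwoPoint p q) / 2) *
          ∫ Y, Real.cos (∑ p ∈ S₀, ∑ a : Fin D, u p a * Y p a) ∂τ,
        Real.exp ((∑ p ∈ S₀, ∑ q ∈ S₀, ∑ a : Fin D, u p a * u q a * curvatureTwoPoint p q) / 2) *
          ∫ Y, Real.sin (∑ p ∈ S₀, ∑ a : Fin D, u p a * Y p a) ∂τ) := ⟨_, fun _ _ => rfl⟩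
  -- the scalar cochains `g_a = (h' - h)_a 1_S` have zero plane sums
  have hgpl : ∀ (a : Fin D) (i j : Fin 4) (hij : i < j),
      ∑ p ∈ S, (if p.2 = ⟨(i, j), hij⟩ then (if p ∈ S then h' p a - h p a else 0) else 0) = 0 := by
    intro a i j hij
    rw [Finset.sum_congr rfl fun p hp => show _ = (if p.2 = ⟨(i, j), hij⟩ then h' p a else 0) -
      (if p.2 = ⟨(i, j), hij⟩ then h p a else 0) by rw [if_pos hp]; split_ifs <;> ring,
      Finset.sum_sub_distrib, hplane i j hij a, sub_self]
  -- MAIN ESTIMATE: for `ε ∈ (0, 1]`, `Ψ_S(h) = e^{Q₁/2} (c₁, s₁)` with data `O(ε)`-close to those of `h'`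
  have key : ∀ ε : ℝ, 0 < ε → ε ≤ 1 → ∃ Q₁ c₁ s₁ : ℝ, Real.exp (Q₁ / 2) * c₁ = (Ψ S h).1 ∧ Real.exp (Q₁ / 2) * s₁ = (Ψ S h).2 ∧
      |Q₁ - ∑ p ∈ S, ∑ q ∈ S, ∑ a : Fin D, h' p a * h' q a * curvatureTwoPoint p q| ≤
          1 / 2 * (2 * (∑ p ∈ S, ∑ a : Fin D, |h' p a|) + D) * D * ε ∧
      |c₁ - ∫ Y, Real.cos (∑ p ∈ S, ∑ a : Fin D, h' p a * Y p a) ∂τ| ≤ (|B| + 1) * D * ε ∧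
      |s₁ - ∫ Y, Real.sin (∑ p ∈ S, ∑ a : Fin D, h' p a * Y p a) ∂τ| ≤ (|B| + 1) * D * ε := by
    intro ε hε hε1
    -- density data (R3), one set per colour; `face κ p` = signed indicator of the faces of the cube `κ`
    choose S' E α K r hSS' hE hcurl hK hsum using fun a : Fin D =>
      HR3 (fun p => if p ∈ S then h' p a - h p a else 0) S (fun p hp => if_neg hp) (hgpl a) ε hε
    set face : (Site 4 × Fin 4 × Fin 4 × Fin 4) → ZdPlaquette 4 → ℝ := fun κ p => if hκ : κ.2.1 < κ.2.2.1 ∧ κ.2.2.1 < κ.2.2.2 then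
        ((if p = (κ.1 + Pi.single κ.2.1 1, ⟨(κ.2.2.1, κ.2.2.2), hκ.2⟩) then (1 : ℝ) else 0) -
          (if p = (κ.1, ⟨(κ.2.2.1, κ.2.2.2), hκ.2⟩) then (1 : ℝ) else 0) -
          (if p = (κ.1 + Pi.single κ.2.2.1 1, ⟨(κ.2.1, κ.2.2.2), hκ.1.trans hκ.2⟩) then (1 : ℝ) else 0) +
          (if p = (κ.1, ⟨(κ.2.1, κ.2.2.2), hκ.1.trans hκ.2⟩) then (1 : ℝ) else 0) +
          (if p = (κ.1 + Pi.single κ.2.2.2 1, ⟨(κ.2.1, κ.2.2.1), hκ.1⟩) then (1 : ℝ) else 0) -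
          (if p = (κ.1, ⟨(κ.2.1, κ.2.2.1), hκ.1⟩) then (1 : ℝ) else 0)) else 0 with hface
    -- the six faces of a cube, and the enlarged plaquette set `S'' = S ∪ ⋃ S'_a ∪ (all faces of all cubes)`
    set F : (κ : Site 4 × Fin 4 × Fin 4 × Fin 4) → κ.2.1 < κ.2.2.1 ∧ κ.2.2.1 < κ.2.2.2 → Finset (ZdPlaquette 4) :=
      fun κ hκ => {(κ.1 + Pi.single κ.2.1 1, ⟨(κ.2.2.1, κ.2.2.2), hκ.2⟩), (κ.1, ⟨(κ.2.2.1, κ.2.2.2), hκ.2⟩),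
        (κ.1 + Pi.single κ.2.2.1 1, ⟨(κ.2.1, κ.2.2.2), hκ.1.trans hκ.2⟩), (κ.1, ⟨(κ.2.1, κ.2.2.2), hκ.1.trans hκ.2⟩),
        (κ.1 + Pi.single κ.2.2.2 1, ⟨(κ.2.1, κ.2.2.1), hκ.1⟩), (κ.1, ⟨(κ.2.1, κ.2.2.1), hκ.1⟩)} with hF
    set S'' : Finset (ZdPlaquette 4) := S ∪ Finset.univ.biUnion S' ∪ Finset.univ.biUnion fun a =>
      (K a).biUnion fun κ => if hκ : κ.2.1 < κ.2.2.1 ∧ κ.2.2.1 < κ.2.2.2 then F κ hκ else ∅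
    have hS1 : S ⊆ S'' := Finset.subset_union_left.trans Finset.subset_union_left
    have hS2 : ∀ a, S' a ⊆ S'' := fun a =>
      (Finset.subset_biUnion_of_mem S' (Finset.mem_univ a)).trans (Finset.subset_union_right.trans Finset.subset_union_left)
    have hS3 : ∀ (a : Fin D) (κ : Site 4 × Fin 4 × Fin 4 × Fin 4), κ ∈ K a →
        ∀ hκ : κ.2.1 < κ.2.2.1 ∧ κ.2.2.1 < κ.2.2.2, F κ hκ ⊆ S'' := fun a κ hκK hκ p hp => by
      refine Finset.mem_union_right _ ?_; simp only [Finset.mem_biUnion, Finset.mem_univ, true_and]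
      exact ⟨a, κ, hκK, by rw [dif_pos hκ]; exact hp⟩
    -- the cube shifts `t ⟨b, κ⟩ = r_b(κ) face(κ) e_b`, their sum, and peeling them off one at a time by (F2)
    set t : (Σ _ : Fin D, Site 4 × Fin 4 × Fin 4 × Fin 4) → ZdPlaquette 4 → Fin D → ℝ :=
      fun x p a => if a = x.1 then r x.1 x.2 * face x.2 p else 0 with ht
    have hcb : ∀ (p : ZdPlaquette 4) (a : Fin D), (∑ x ∈ Finset.univ.sigma K, t x) p a = ∑ κ ∈ K a, r a κ * face κ p := by
      intro p a; rw [Finset.sum_apply, Finset.sum_apply, Finset.sum_sigma, Finset.sum_eq_single_of_mem a (Finset.mem_univ a) fun b _ hb => ?_]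
      exacts [by simp [ht], by simp [ht, Ne.symm hb]]
    have hpeel : ∀ u : ZdPlaquette 4 → Fin D → ℝ, Ψ S'' (u + ∑ x ∈ Finset.univ.sigma K, t x) = Ψ S'' u := by
      refine Factorization.apply_add_sum_eq (Ψ S'') t _ ?_
      rintro ⟨b, κ⟩ hx u
      have hκK : κ ∈ K b := (Finset.mem_sigma.mp hx).2
      obtain ⟨hij, hjk, -⟩ := hK b κ hκK
      have hsub := hS3 b κ hκK ⟨hij, hjk⟩
      have H := HF2 D τ hT1 S'' u κ.1 κ.2.1 κ.2.2.1 κ.2.2.2 hij hjk b (r b κ) (hsub (by simp [hF])) (hsub (by simp [hF]))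
        (hsub (by simp [hF])) (hsub (by simp [hF])) (hsub (by simp [hF])) (hsub (by simp [hF]))
      simp only [] at H; rw [hΨ, hΨ]; simp only [Pi.add_apply, ht, hface, dif_pos (And.intro hij hjk)]
      exact Prod.ext H.1 H.2
    -- removing the exact part by (F1), and restricting back to `S`
    have hexact : Ψ S'' (fun p a => (if p ∈ S then h p a else 0) + plaquetteCurl (α a) p) =
        Ψ S'' (fun p a => if p ∈ S then h p a else 0) := by
      have H := HF1 D τ hτ hInt hT3 S'' (Finset.univ.biUnion E) (fun p a => if p ∈ S then h p a else 0) (fun e a => α a e)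
        (fun e he => funext fun a => hE a e fun hm => he (Finset.mem_biUnion.mpr ⟨a, Finset.mem_univ a, hm⟩))
        (fun p hp a => hcurl a p fun hm => hp (hS2 a hm))
      rw [hΨ, hΨ]; exact Prod.ext H.1 H.2
    have hrestr : ∀ w : ZdPlaquette 4 → Fin D → ℝ, Ψ S'' (fun p a => if p ∈ S then w p a else 0) = Ψ S w := fun w => by
      simp only [hΨ, Factorization.sum_ite_mul_eq hS1, Factorization.sum_sum_ite_mul_ite_eq hS1]
    -- the two cochains compared on `S''`: `u = h' 1_S` and `v = h 1_S + dα + cubes`, with `Ψ_{S''}(v) = Ψ_S(h)`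
    set u : ZdPlaquette 4 → Fin D → ℝ := fun p a => if p ∈ S then h' p a else 0 with hu
    set v : ZdPlaquette 4 → Fin D → ℝ := (fun p a => (if p ∈ S then h p a else 0) + plaquetteCurl (α a) p) +
      ∑ x ∈ Finset.univ.sigma K, t x with hv
    have hΨv : Ψ S'' v = Ψ S h := by rw [hv, hpeel, hexact, hrestr]
    have hvu : ∀ (p : ZdPlaquette 4) (a : Fin D), v p a - u p a =
        -((if p ∈ S then h' p a - h p a else 0) - plaquetteCurl (α a) p - ∑ κ ∈ K a, r a κ * face κ p) := by
      intro p a; simp only [hv, hu, Pi.add_apply, hcb]; split_ifs <;> ring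
    -- `‖v - u‖_{ℓ¹(S'')} ≤ D ε` (colour by colour; all three terms vanish on `S'' \ S'_a`)
    have hΔ : ∑ p ∈ S'', ∑ a : Fin D, |v p a - u p a| ≤ D * ε := by
      rw [Finset.sum_comm]; refine (Finset.sum_le_sum fun a _ => show ∑ p ∈ S'', |v p a - u p a| ≤ ε from ?_).trans (by simp)
      rw [← Finset.sum_subset (hS2 a)]
      · exact le_of_lt (lt_of_le_of_lt (le_of_eq (Finset.sum_congr rfl fun p _ => by rw [hvu, abs_neg])) (hsum a))
      · intro p _ hp
        rw [hvu, abs_neg, if_neg fun hm => hp (hSS' a hm), hcurl a p hp, Finset.sum_eq_zero fun κ hκ => ?_]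
        · simp
        · by_cases hf : face κ p = 0
          · rw [hf, mul_zero]
          · exact absurd ((hK a κ hκ).2.2 p hf) hp
    -- `ℓ¹(S'')`-norms of `u` and `v`
    have hNu : ∑ p ∈ S'', ∑ a : Fin D, |u p a| = ∑ p ∈ S, ∑ a : Fin D, |h' p a| := Factorization.sum_abs_ite_eq hS1 h'
    have hNv : ∑ p ∈ S'', ∑ a : Fin D, |v p a| ≤ (∑ p ∈ S, ∑ a : Fin D, |h' p a|) + D * ε := by
      calc ∑ p ∈ S'', ∑ a : Fin D, |v p a| ≤ ∑ p ∈ S'', ∑ a : Fin D, (|u p a| + |v p a - u p a|) :=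
            Finset.sum_le_sum fun p _ => Finset.sum_le_sum fun a _ => by linarith [abs_sub_abs_le_abs_sub (v p a) (u p a)]
        _ ≤ (∑ p ∈ S, ∑ a : Fin D, |h' p a|) + D * ε := by
            rw [Finset.sum_congr rfl fun p _ => Finset.sum_add_distrib, Finset.sum_add_distrib, hNu]
            exact add_le_add le_rfl hΔ
    -- continuity of `Q`
    have hQ : |(∑ p ∈ S'', ∑ q ∈ S'', ∑ a : Fin D, v p a * v q a * curvatureTwoPoint p q) -
        ∑ p ∈ S, ∑ q ∈ S, ∑ a : Fin D, h' p a * h' q a * curvatureTwoPoint p q| ≤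
        1 / 2 * (2 * (∑ p ∈ S, ∑ a : Fin D, |h' p a|) + D) * D * ε := by
      rw [← Factorization.sum_sum_ite_mul_ite_eq hS1 h' curvatureTwoPoint]
      refine (Factorization.abs_quad_sub_quad_le curvatureTwoPoint Factorization.abs_curvatureTwoPoint_le S'' v u).trans ?_
      rw [hNu]; have hD : (0 : ℝ) ≤ D := Nat.cast_nonneg D
      calc 1 / 2 * ((∑ p ∈ S'', ∑ a : Fin D, |v p a|) + ∑ p ∈ S, ∑ a : Fin D, |h' p a|) * ∑ p ∈ S'', ∑ a : Fin D, |v p a - u p a|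
          ≤ 1 / 2 * ((∑ p ∈ S, ∑ a : Fin D, |h' p a|) + D * 1 + ∑ p ∈ S, ∑ a : Fin D, |h' p a|) * (D * ε) := by
            gcongr; exact hNv.trans (by gcongr)
        _ = 1 / 2 * (2 * (∑ p ∈ S, ∑ a : Fin D, |h' p a|) + D) * D * ε := by ring
    -- continuity of `E cos`, `E sin` (both bounded by `1` and `1`-Lipschitz)
    have hCS : ∀ {f : ℝ → ℝ}, Continuous f → (∀ x, |f x| ≤ 1) → (∀ x y, |f x - f y| ≤ |x - y|) →
        |(∫ Y, f (∑ p ∈ S'', ∑ a : Fin D, v p a * Y p a) ∂τ) - ∫ Y, f (∑ p ∈ S, ∑ a : Fin D, h' p a * Y p a) ∂τ|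
          ≤ (|B| + 1) * D * ε := by
      intro f hf hf1 hfL
      rw [show (fun Y => f (∑ p ∈ S, ∑ a : Fin D, h' p a * Y p a)) =
        fun Y : ZdPlaquette 4 → Fin D → ℝ => f (∑ p ∈ S'', ∑ a : Fin D, u p a * Y p a) by
          simp only [hu, Factorization.sum_ite_mul_eq hS1]]
      refine (Factorization.abs_integral_sub_integral_le τ hInt hM hf hf1 hfL S'' v u).trans ?_
      calc (|B| + 1) * ∑ p ∈ S'', ∑ a : Fin D, |v p a - u p a| ≤ (|B| + 1) * (D * ε) := by gcongr
        _ = (|B| + 1) * D * ε := by ring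
    refine ⟨∑ p ∈ S'', ∑ q ∈ S'', ∑ a : Fin D, v p a * v q a * curvatureTwoPoint p q,
      ∫ Y, Real.cos (∑ p ∈ S'', ∑ a : Fin D, v p a * Y p a) ∂τ, ∫ Y, Real.sin (∑ p ∈ S'', ∑ a : Fin D, v p a * Y p a) ∂τ,
      (congrArg Prod.fst (hΨ S'' v)).symm.trans (congrArg Prod.fst hΨv),
      (congrArg Prod.snd (hΨ S'' v)).symm.trans (congrArg Prod.snd hΨv), hQ,
      hCS Real.continuous_cos Real.abs_cos_le_one Real.abs_cos_sub_cos_le,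
      hCS Real.continuous_sin Real.abs_sin_le_one Real.abs_sin_sub_sin_le⟩
  simpa only [hΨ] using Factorization.eq_of_approx key

/-- **Registered anchor of this file** (the full statement of STUB F5 exceeds the stub registry's signature cap): the
`ℓ¹`-continuity of the quadratic functional `Q_S` of the curvature kernel on `ℤ⁴`, the continuity half of F5
(`Factorization.abs_quad_sub_quad_le` with `|T(p,q)| ≤ 1/2`, `Factorization.abs_curvatureTwoPoint_le`). -/
theorem stub_factorizationQuadContinuity :
    ∀ (D : ℕ) (S : Finset (Literature.MathematicalPhysics.QuantumLattice.ZdPlaquette 4)) (u v :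
      Literature.MathematicalPhysics.QuantumLattice.ZdPlaquette 4 → Fin D → ℝ), |(∑ p ∈ S, ∑ q ∈ S, ∑ a : Fin D, u p
      a * u q a * Literature.MathematicalPhysics.QuantumFieldTheory.curvatureTwoPoint p q) - ∑ p ∈ S, ∑ q ∈ S, ∑ a :
      Fin D, v p a * v q a * Literature.MathematicalPhysics.QuantumFieldTheory.curvatureTwoPoint p q| ≤ 1 / 2 * ((∑
      p ∈ S, ∑ a : Fin D, |u p a|) + ∑ p ∈ S, ∑ a : Fin D, |v p a|) * ∑ p ∈ S, ∑ a : Fin D, |u p a - v p a| :=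
  fun _ S u v => Factorization.abs_quad_sub_quad_le _ Factorization.abs_curvatureTwoPoint_le S u v

end Summit.QuantumFields.YangMills.Theorems.EquipartitionPinsProbe
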